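import Summits.Ventures.PercRepro.Night2ThreeTwoEleven

/-!
# PercRepro — **THE `(3, 2)` FLATS WITH `|V| = 8` SATISFY (LI_G)** (night-2, gen 26)

The smallest flats of the cell `(3, 2)` — `|E ∖ G| = 3`, two coloops, `|V| = 8` — need no common line and no count in
the middle: a lossy basis pair `(B, z)` has `D = 2^4 − 1 = 15` targets, and its ELEVEN top targets (the supersets of
`B ∪ {z}` missing at most two points of `G`) already pay for it.  There `cap2 = 1` (`cap2_eq_one_of_card_le`), the
targets with `|T ∖ K| ≥ 7` carry no distance-one load at all (a source needs `|T ∖ K| + 2 ≤ |V|`,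
`card_bounds_of_source`), those with `|T ∖ K| = 6` carry at most `3/20 + 15/198` (three fat sources, at most
`C(6, 2)` sources in all), and the mass of a target is at most `C(|T ∖ K|, 4) · E/15` with the chord `E = 2/5`
(`pi2MassH_le_coverBases`, `faceLoss_sum_le_three_two`).  The income is
`6 · (1 − 3/20 − 15/198)/(2/5) + 4 · (15/14) + 15/28 = 16.43 ≥ 15`.

* **`localShadowHall_three_two_five_eight`**: (LI_G) at every flat of the cell `(3, 2)` with `|V| = 8`
  (no saturation or fat-member hypothesis is needed);
* `eight_le_card_of_fatMember`: a big member forces `|V| ≥ 8`;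
* **`shadowHall_seven_five_of_residuesZ'`**: `ShadowHall M 7 5 (phiK 7 5)` for every finite matroid modulo `(2, 0)`,
  `(2, 1)` as in the residues V and the `(3, 2)` obstruction cells with `9 ≤ |V| ≤ 10`.
-/

namespace PercRepro.Shadow

open Finset PerFlat ThmH

variable {α : Type*} [DecidableEq α] {M : Matroid α} [M.Finite]

section Eight

variable {G : Finset α}

open scoped Classical in
/-- The covering bases of a target number at most `C(|T ∖ K|, 4)`. -/
theorem card_coverBases_le_choose (G S : Finset α) : (coverBases M G S 4).card ≤ (S \ coloops M G).card.choose 4 := by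
  have hsub : coverBases M G S 4 ⊆ (S \ coloops M G).powersetCard 4 := Finset.filter_subset _ _
  exact (Finset.card_le_card hsub).trans (le_of_eq (Finset.card_powersetCard 4 _))

open scoped Classical in
/-- A target with `|T ∖ K| + 2 > |V|` has no missed source, hence no distance-one load. -/
theorem dload_missed_eq_zero_of_large (hG : G ∈ flatsQ M (5 + 1)) (hd : (gr M \ G).card = 3) (hk : kColoops M G = 2)
    (hs : ∀ e ∈ gr M, ∀ f ∈ gr M, e ≠ f → rkN M {e, f} = 2) (hl : ∀ e ∈ gr M, M.Indep {e})
    {P : Finset α → Prop} [DecidablePred P] (hP : ∀ B, P B → 4 ≤ (B \ coloops M G).card) {S : Finset α}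
    (hbig : (G \ coloops M G).card < (S \ coloops M G).card + 2) :
    dload M 5 G P (dshMissed M 5 G) S = 0 := by
  have hd' : (gr M \ G).card ≤ 5 := by omega
  have hempty : missedSources M 5 G P S = ∅ := by
    rw [Finset.eq_empty_iff_forall_notMem]
    intro B hB
    have := (card_bounds_of_source hG hd hP hB).1
    omega
  have h1 := dload_missed_le_card_sources_three_two hG hd hk hs hl hP S
  rw [hempty, Finset.card_empty] at h1
  have h0 : 0 ≤ dload M 5 G P (dshMissed M 5 G) S :=
    dload_nonneg (fun B z S => dshMissed_nonneg hG hd' B z S) S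
  push_cast at h1
  linarith

open scoped Classical in
/-- At a target with `|T ∖ K| = 6` of a flat with `|V| = 8`, the distance-one load is at most `3/20 + 15/198`. -/
theorem dload_missed_le_of_six (hG : G ∈ flatsQ M (5 + 1)) (hd : (gr M \ G).card = 3) (hk : kColoops M G = 2)
    (hs : ∀ e ∈ gr M, ∀ f ∈ gr M, e ≠ f → rkN M {e, f} = 2) (hl : ∀ e ∈ gr M, M.Indep {e})
    (h8 : 8 ≤ (G \ coloops M G).card) {P : Finset α → Prop} [DecidablePred P]
    (hP : ∀ B, P B → 4 ≤ (B \ coloops M G).card) {S : Finset α} (hS6 : (S \ coloops M G).card = 6) :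
    dload M 5 G P (dshMissed M 5 G) S ≤ 3 / 20 + 15 / 198 := by
  have hd' : (gr M \ G).card ≤ 5 := by omega
  have hw := dload_missed_le_weighted hG hd hk hs hl hP S
  have hfat := card_fat_sources_le_three hG hd' hk hs h8 (P := P) S
  have hthree : ((missedSources M 5 G P S).filter (fun B => (G \ clF M B).card = 3)).card ≤ 15 := by
    have h1 := Finset.card_filter_le (missedSources M 5 G P S) (fun B => (G \ clF M B).card = 3)
    have h2 := card_missedSources_le_choose hG hd' (P := P) S
    rw [hS6] at h2
    have : Nat.choose 6 2 = 15 := by decide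
    omega
  have hfat' : (((missedSources M 5 G P S).filter (fun B => (G \ clF M B).card = 2)).card : ℚ) ≤ 3 := by
    exact_mod_cast hfat
  have hthree' : (((missedSources M 5 G P S).filter (fun B => (G \ clF M B).card = 3)).card : ℚ) ≤ 15 := by
    exact_mod_cast hthree
  nlinarith

open scoped Classical in
/-- **THE FLATS OF THE CELL `(3, 2)` WITH `|V| = 8` SATISFY (LI_G)**: the eleven top targets of a lossy basis pair pay
`16.43 ≥ 15`. -/
theorem localShadowHall_three_two_five_eight (hG : G ∈ flatsQ M (5 + 1)) (hd : (gr M \ G).card = 3)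
    (hk : kColoops M G = 2) (hs : ∀ e ∈ gr M, ∀ f ∈ gr M, e ≠ f → rkN M {e, f} = 2)
    (hl : ∀ e ∈ gr M, M.Indep {e}) (h8 : (G \ coloops M G).card = 8) : LocalShadowHall M 5 G := by
  have hd' : (gr M \ G).card ≤ 5 := by omega
  have hk' : kColoops M G + 4 = 5 + 1 := by omega
  have hKG : coloops M G ⊆ G := fun y hy => (mem_coloops.1 hy).1
  have hGcard : G.card = 10 := by
    have := Finset.card_sdiff_of_subset hKG
    rw [h8, ← kColoops_eq_card_coloops, hk] at this
    omega
  have hdl : ∀ S ∈ shadowAt M (5 + 2) 5 (Uq M (5 + 2) 5) G,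
      dload M 5 G (BigMember M G) (dshMissed M 5 G) S ≤ cap2 M 5 G S :=
    fun S _ => dload_missed_le_cap2_three_two hG hd hk hs hl (fun _ h => h) S
  apply localShadowHall_three_two_five_of_basisFair hG hd hk hs hl
  intro B hB hnB z hz
  by_cases hl0 : loss M 5 G B z = 0
  · rw [hl0]
    exact mul_nonneg (rhoL_nonneg hG hd' B z) (lossIncomeH_nonneg hG hd' hdl B z)
  have hB' : B ∈ membersIn M (Uq M (5 + 2) 5) G := (mem_thinMembers.1 hB).1
  have hBU : B ∈ Uq M (5 + 2) 5 := (mem_membersIn.1 hB').1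
  have hKB : coloops M G ⊆ B := coloops_subset_of_mem_thinMembers hG hd' hB
  have hB3 : (B \ coloops M G).card + 1 = 4 := by
    have := card_sdiff_coloops_thin_ge hG hd' hk' hB
    unfold BigMember at hnB
    omega
  have hzB : z ∉ B := notMem_of_notMem_clF hBU (Finset.mem_sdiff.1 hz).2
  have hr : (G \ insert z B).card = 4 := by
    rw [card_sdiff_insert_eq_dqm1 hG hd' hB hB3 hz, hGcard, hk]
  have hQcard : (insert z B).card = 6 := by
    have hQG : insert z B ⊆ G := Finset.insert_subset (Finset.mem_sdiff.1 hz).1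
      ((subset_clF hBU).trans (mem_membersIn.1 hB').2)
    have := Finset.card_sdiff_of_subset hQG
    omega
  set D : ℚ := ((2 ^ ((G.card - kColoops M G) - 4) - 1 : ℕ) : ℚ) with hD
  have hD15 : D = 15 := by rw [hD, hGcard, hk]; norm_num
  have hT : ((tgtSets M 5 G B z).card : ℚ) = D := by
    rw [card_tgtSets hG hB' hz, hr, hD, hGcard, hk]
  have hrho : rhoL M 5 G B z = loss M 5 G B z / D := by
    unfold rhoL; rw [hT]
  -- the chord bound on every covering basis
  set E : ℚ := ((8 : ℚ) + 56) / (20 * 8) with hE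
  have hTE : ∀ S ⊆ G, ∀ T ∈ coverBases M G S 4, ∑ w ∈ T, faceLoss M 5 G (coloops M G ∪ T) w ≤ E := by
    intro S _ T hT
    have := faceLoss_sum_le_three_two hG hd hk hs hl (by omega) T hT
    rw [h8] at this
    rw [hE]; push_cast at this ⊢; linarith
  -- every target: `|T ∖ K| = |T| − 2`, `T ⊆ G`
  have hTK : ∀ T ∈ tgtSets M 5 G B z, coloops M G ⊆ T ∧ T ⊆ G ∧ (T \ coloops M G).card + 2 = T.card := by
    intro T hT
    obtain ⟨hTsh, hQT, -⟩ := mem_tgtSets.1 hT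
    have hKT : coloops M G ⊆ T := hKB.trans ((Finset.subset_insert z B).trans hQT)
    refine ⟨hKT, subset_G_of_mem_shadowAt hTsh, ?_⟩
    have := Finset.card_sdiff_of_subset hKT
    rw [← kColoops_eq_card_coloops, hk] at this
    have := Finset.card_le_card hKT
    rw [← kColoops_eq_card_coloops, hk] at this
    omega
  -- the bounds by size
  set u : Finset α → ℚ := fun T => ((T.card - 2).choose 4 : ℚ) * (E / D) with hu_def
  set v : Finset α → ℚ := fun T => if T.card = 8 then 1 - 3 / 20 - 15 / 198 else if 9 ≤ T.card then 1 else 0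
    with hv_def
  have hu : ∀ T ∈ tgtSets M 5 G B z, pi2MassH M 5 G (BigMember M G) T ≤ u T := by
    intro T hT
    obtain ⟨-, hTG, hcard⟩ := hTK T hT
    have hP' : ∀ B ∈ thinMembers M 5 G, ¬ BigMember M G B → (B \ coloops M G).card + 1 = 4 := by
      intro B hB hnP
      have h3 := card_sdiff_coloops_thin_ge hG hd' hk' hB
      unfold BigMember at hnP
      omega
    have h1 := pi2MassH_le_coverBases hG hd (by norm_num) hk' hP' T (hTE T hTG)
    have h2 : ((coverBases M G T 4).card : ℚ) ≤ ((T.card - 2).choose 4 : ℚ) := by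
      have := card_coverBases_le_choose (M := M) G T
      rw [show (T \ coloops M G).card = T.card - 2 by omega] at this
      exact_mod_cast this
    have hED : 0 ≤ E / D := by rw [hE, hD15]; norm_num
    simp only [hu_def]
    calc pi2MassH M 5 G (BigMember M G) T ≤ ((coverBases M G T 4).card : ℚ) * (E / D) := h1
      _ ≤ ((T.card - 2).choose 4 : ℚ) * (E / D) := mul_le_mul_of_nonneg_right h2 hED
  have hv : ∀ T ∈ tgtSets M 5 G B z, v T ≤ cap3 M 5 G (BigMember M G) (dshMissed M 5 G) T := by
    intro T hT
    obtain ⟨-, hTG, hcard⟩ := hTK T hT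
    have hTsh := (mem_tgtSets.1 hT).1
    have hGT : (G \ T).card + T.card = 10 := by
      rw [Finset.card_sdiff_of_subset hTG, hGcard]
      have := Finset.card_le_card hTG
      omega
    simp only [hv_def]
    split_ifs with h8' h9
    · -- `|T ∖ K| = 6`: `cap2 = 1`, `dload ≤ 3/20 + 15/198`
      have hc1 : cap2 M 5 G T = 1 := by
        apply cap2_eq_one_of_card_le hG
        omega
      have hdl6 := dload_missed_le_of_six hG hd hk hs hl (by omega) (fun _ h => h) (S := T) (by omega)
      unfold cap3
      linarith
    · -- `|T ∖ K| ≥ 7`: `cap2 = 1`, no load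
      have hc1 : cap2 M 5 G T = 1 := by
        apply cap2_eq_one_of_card_le hG
        omega
      have hdl0 := dload_missed_eq_zero_of_large hG hd hk hs hl (fun _ h => h) (S := T) (by omega)
      unfold cap3
      linarith
    · exact cap3_nonneg (hdl T hTsh)
  have hv0 : ∀ T ∈ tgtSets M 5 G B z, 0 ≤ v T := by
    intro T _
    simp only [hv_def]
    split_ifs <;> norm_num
  have hinc := lossIncomeH_ge_of_subfamily hG hd' hdl hB hnB hz hl0 (Finset.Subset.refl _) u v hu hv hv0
  -- the sum over the targets by size
  have hsum : ∑ T ∈ tgtSets M 5 G B z, v T / u T =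
      ∑ j ∈ Finset.Icc 1 4, ((4 : ℕ).choose j : ℚ) *
        ((if 6 + j = 8 then 1 - 3 / 20 - 15 / 198 else if 9 ≤ 6 + j then (1 : ℚ) else 0) /
          (((6 + j - 2).choose 4 : ℚ) * (E / D))) := by
    have := sum_tgtSets_apply_card hG hB' hz (fun c => (if c = 8 then 1 - 3 / 20 - 15 / 198 else if 9 ≤ c then (1 : ℚ) else 0) /
      (((c - 2).choose 4 : ℚ) * (E / D)))
    rw [hr, hQcard] at this
    simp only [hu_def, hv_def]
    exact this
  have hD' : D ≤ ∑ T ∈ tgtSets M 5 G B z, v T / u T := by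
    rw [hsum, hD15, hE, show (Finset.Icc 1 4 : Finset ℕ) = {1, 2, 3, 4} from by decide]
    norm_num [Finset.sum_insert, Nat.choose]
  rw [hrho]
  have hl1 : 0 ≤ loss M 5 G B z := loss_nonneg' hG hd' B z
  have hDpos : (0 : ℚ) < D := by rw [hD15]; norm_num
  calc loss M 5 G B z = loss M 5 G B z / D * D := by field_simp
    _ ≤ loss M 5 G B z / D * lossIncomeH M 5 G (BigMember M G) (dshMissed M 5 G) B z :=
        mul_le_mul_of_nonneg_left (hD'.trans hinc) (div_nonneg hl1 hDpos.le)

end Eight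

section SevenFiveZ'

variable {α' : Type} [DecidableEq α']

open scoped Classical in
/-- A big member (four points off the coloops) forces `|V| ≥ 8`: its complement in `G` has `≥ 4` points. -/
theorem eight_le_card_of_fatMember (N : Matroid α') [N.Finite] {G : Finset α'} (hG : G ∈ flatsQ N (5 + 1))
    (hd : (gr N \ G).card = 3) (hfm : FatMember N G 4 2) : 8 ≤ (G \ coloops N G).card := by
  obtain ⟨B, hB, h4, -⟩ := hfm
  have hd' : (gr N \ G).card ≤ 5 := by omega
  have hBU : B ∈ Uq N (5 + 2) 5 := (mem_membersIn.1 (mem_thinMembers.1 hB).1).1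
  have hBG : B ⊆ G := (subset_clF hBU).trans (mem_membersIn.1 (mem_thinMembers.1 hB).1).2
  have hKB : coloops N G ⊆ B := coloops_subset_of_mem_thinMembers hG hd' hB
  have h1 := four_le_card_sdiff_of_mem_Uq hG hd hBU hBG
  have hsub : (G \ B) ∪ (B \ coloops N G) ⊆ G \ coloops N G := by
    intro a ha
    rw [Finset.mem_union, Finset.mem_sdiff, Finset.mem_sdiff] at ha
    rw [Finset.mem_sdiff]
    rcases ha with ⟨haG, haB⟩ | ⟨haB, haK⟩
    · exact ⟨haG, fun h => haB (hKB h)⟩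
    · exact ⟨hBG haB, haK⟩
  have hdisj : Disjoint (G \ B) (B \ coloops N G) := by
    rw [Finset.disjoint_left]; intro a ha hb
    exact (Finset.mem_sdiff.1 ha).2 (Finset.mem_sdiff.1 hb).1
  have := Finset.card_le_card hsub
  rw [Finset.card_union_of_disjoint hdisj] at this
  omega

open scoped Classical in
/-- **THE `(7, 5)` SHADOW ROW FOR EVERY FINITE MATROID MODULO THE RESIDUES Z′**: `(2, 0)`, `(2, 1)` as in the residues V
and, at `(3, 2)`, only the obstruction cells with `9 ≤ |V| ≤ 10`. -/
theorem shadowHall_seven_five_of_residuesZ'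
    (h20 : ∀ (N : Matroid α') [N.Finite] (G : Finset α'), CellHyp N G →
      (gr N \ G).card = 2 → kColoops N G = 0 → FatMember N G 6 3 →
      (FatBasis N G 6 2 ∨ FatMember N G 6 2) →
      (2 ≤ (fatClosures N 5 G 2).card ∨
        ∃ B ∈ thinMembers N 5 G, 2 < (G \ clF N B).card ∧ (G \ clF N B).card < 5) →
      LocalShadowHall N 5 G)
    (h21 : ∀ (N : Matroid α') [N.Finite] (G : Finset α'), CellHyp N G →
      (gr N \ G).card = 2 → kColoops N G = 1 → FatMember N G 5 4 →
      (FatBasis N G 5 3 ∨ FatMember N G 5 3) →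
      (2 ≤ (fatClosures N 5 G 2).card ∨
        ∃ B ∈ thinMembers N 5 G, 2 < (G \ clF N B).card ∧ (G \ clF N B).card < 7) →
      LocalShadowHall N 5 G)
    (h32 : ∀ (N : Matroid α') [N.Finite] (G : Finset α'), CellHyp N G →
      (gr N \ G).card = 3 → kColoops N G = 2 → FatMember N G 4 2 →
      (∃ S ∈ shadowAt N (5 + 2) 5 (Uq N (5 + 2) 5) G, 4 + 1 ≤ (S \ coloops N G).card ∧
        capS N 5 G S < L1 N 5 G S) →
      9 ≤ (G \ coloops N G).card → (G \ coloops N G).card ≤ 10 → LocalShadowHall N 5 G)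
    (M : Matroid α') [M.Finite] : ShadowHall M 7 5 (phiK 7 5) := by
  apply shadowHall_seven_five_of_residuesZ h20 h21
  intro N _ G hcell hd hk hfm hsat h10
  have h8 := eight_le_card_of_fatMember N hcell.2.2.2 hd hfm
  by_cases h9 : 9 ≤ (G \ coloops N G).card
  · exact h32 N G hcell hd hk hfm hsat h9 h10
  · exact localShadowHall_three_two_five_eight hcell.2.2.2 hd hk hcell.1 hcell.2.1 (by omega)

end SevenFiveZ'

end PercRepro.Shadow
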